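import Literature.Probability.Percolation.RussoFormula
import Literature.Probability.Percolation.SitePercolationMeasure
import HarnessLib

/-!
# Russo's formula for Bernoulli site percolation

Topic `Literature/Probability/Percolation`. A layer of the discharge of
`Literature.Probability.Percolation.triCriticalProb_eq_half` (Kesten 1982, §3.4: `p_c^site(𝕋) = 1/2`), whose upper
bound uses the mean-field lower bound of Duminil-Copin–Tassion (*Comm. Math. Phys.* 343
(2016), Thm. 1.1 and Lemma 1.4), obtained by differentiating `P_p(0 ⟷ ∂Λ)` in `p`.

Russo's formula (Russo, *Z. Wahrsch. verw. Gebiete* 56 (1981), §4, Lemma 3, eq. (4.2):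
`d/dx μ_x(A) = ⟨n(A)⟩_{μ_x}` for a positive event `A`, `n(A) = Σ_i χ_{δ_i A}` the number of
pivotal sites — Russo's paper *is* about site variables; Grimmett 1999, Thm. 2.25) for
**site** percolation `sitePercolation V p = setBer(univ, p)`:

* `site_russo_formula_sum` — for an increasing event `A` determined by a finite set `F` of
  sites, `q ↦ P_q(A)` has derivative `Σ_{v ∈ F} P_p(v pivotal for A)` at every `p ∈ (0, 1)`;
* `sitePercolation_real_not_mem_and_insert_mem` — for increasing `A` determined by the finite
  `F`, `P_p(ω ∉ A, ω ∪ {v} ∈ A) = (1 - p) · P_p(v pivotal for A)` (pivotality does not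
  depend on the state of `v`, which is closed with probability `1 - p` independently);
* `site_russo_formula_sum_closedPivotal` — the derivative rewritten as
  `(1 - p)⁻¹ Σ_{v ∈ F} P_p(ω ∉ A, ω ∪ {v} ∈ A)`, the form used by Duminil-Copin–Tassion
  (2016, proof of Lemma 1.4: "`β P[e pivotal] ≥ (1 - e^{-β}) P[e pivotal, 0 ↮ Λᶜ]`").

The computation is the tree's one-variable proof of Russo's formula for `setBer(u, q)`
(`RussoFormula.lean`, helpers `Literature.CritPerc.Russo.*`, generic in the carrier set `u`),
specialised to `u = univ`.

## References

* L. Russo, On the critical percolation probabilities, *Z. Wahrsch. verw. Gebiete* 56 (1981)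
  229–237, §4, Lemma 3, (4.1)–(4.2) [RussoZW1981].
* G. Grimmett, *Percolation*, 2nd ed., Springer 1999, Thm. 2.25.
* H. Duminil-Copin, V. Tassion, *Comm. Math. Phys.* 343 (2016) 725–745, Lemma 1.4
  [DuminilCopinTassionCMP2016].

## Mathlib / tree

Mathlib: `HasDerivAt`, `Set.projIcc`. Tree: `Russo.cylPoly`, `Russo.measureReal_eq_cylPoly`,
`Russo.hasDerivAt_cylPoly`, `Russo.sum_dweight_eq_measureReal_pivotal`,
`Russo.determinedBy_isPivotal`, `Russo.isPivotal_iff_of_notMem` (`RussoFormula.lean`),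
`IsPivotal`, `DeterminedBy` (`PercolationEvents.lean`), `sitePercolation_real_inter_of_disjoint`
(`SitePercolationMeasure.lean`). The bond version is `russo_formula_sum_holds`.
-/

noncomputable section

namespace Literature.Probability.Percolation

open MeasureTheory

variable {V : Type*}

/-- **Russo's formula for site percolation, sum form** (Russo 1981, §4, Lemma 3, (4.2) with
(4.1); Grimmett 1999, Thm. 2.25): for an increasing event `A` determined by a finite set `F`
of sites and `p ∈ (0, 1)`,
`d/dq P_q(A) |_{q = p} = Σ_{v ∈ F} P_p(v is pivotal for A)`.
(Here `q ↦ P_q(A)` is extended constantly outside `[0, 1]` through `Set.projIcc`.) [cite: RussoZW1981, §4 Lemma 3 (4.2)] -/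
theorem site_russo_formula_sum {A : Set (SiteConfig V)} (hA : IsUpperSet A) (F : Finset V)
    (hF : DeterminedBy A ↑F) {p : ℝ} (hp : p ∈ Set.Ioo (0 : ℝ) 1) :
    HasDerivAt (fun q : ℝ => (sitePercolation V (Set.projIcc 0 1 zero_le_one q)).real A)
      (∑ v ∈ F, (sitePercolation V (Set.projIcc 0 1 zero_le_one p)).real
        {ω | IsPivotal A v ω}) p := by
  classical
  have hpI : p ∈ Set.Icc (0 : ℝ) 1 := ⟨hp.1.le, hp.2.le⟩
  have heq : Russo.cylPoly (Set.univ : Set V) F A =ᶠ[nhds p]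
      (fun q : ℝ => (sitePercolation V (Set.projIcc 0 1 zero_le_one q)).real A) := by
    filter_upwards [Ioo_mem_nhds hp.1 hp.2] with q hq
    rw [Set.projIcc_of_mem _ ⟨hq.1.le, hq.2.le⟩, sitePercolation]
    exact (Russo.measureReal_eq_cylPoly hF Set.univ ⟨q, hq.1.le, hq.2.le⟩).symm
  refine ((Russo.hasDerivAt_cylPoly Set.univ F A p).congr_deriv ?_).congr_of_eventuallyEq
    heq.symm
  rw [Set.projIcc_of_mem _ hpI]
  refine Finset.sum_congr rfl fun v hv => ?_
  rw [sitePercolation, Russo.sum_dweight_eq_measureReal_pivotal hA hF Set.univ ⟨p, hpI⟩ hv]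
  simp

/-- For an increasing event, `{ω ∉ A, ω ∪ {v} ∈ A} = {v pivotal} ∩ {v closed}`. [folklore] -/
theorem setOf_not_mem_and_insert_mem_eq {A : Set (SiteConfig V)} (hA : IsUpperSet A) (v : V) :
    {ω : SiteConfig V | ω ∉ A ∧ insert v ω ∈ A} = {ω | IsPivotal A v ω} ∩ {ω | v ∉ ω} := by
  ext ω
  simp only [Set.mem_setOf_eq, Set.mem_inter_iff]
  constructor
  · rintro ⟨hω, hins⟩
    have hv : v ∉ ω := fun hv => hω (by rwa [Set.insert_eq_of_mem hv] at hins)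
    exact ⟨(Russo.isPivotal_iff_of_notMem hA hv).2 ⟨hins, hω⟩, hv⟩
  · rintro ⟨hpiv, hv⟩
    have := (Russo.isPivotal_iff_of_notMem hA hv).1 hpiv
    exact ⟨this.2, this.1⟩

/-- **`P_p(ω ∉ A, ω ∪ {v} ∈ A) = (1 - p) · P_p(v pivotal)`** for an increasing event `A`
determined by a finite set `F` of sites: pivotality of `v` is determined by `F \ {v}`
(Russo 1981, §4, proof of Lemma 3: `δ_i A ∈ 𝒜_{Λ ∖ {i}}`), hence independent of the state
of `v`. [cite: RussoZW1981, §4 Lemma 3 (proof)] -/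
theorem sitePercolation_real_not_mem_and_insert_mem (p : unitInterval) {A : Set (SiteConfig V)}
    (hA : IsUpperSet A) {F : Finset V} (hF : DeterminedBy A ↑F) (v : V) :
    (sitePercolation V p).real {ω | ω ∉ A ∧ insert v ω ∈ A} =
      (1 - p) * (sitePercolation V p).real {ω | IsPivotal A v ω} := by
  classical
  rw [setOf_not_mem_and_insert_mem_eq hA v]
  have hpiv : DeterminedBy {ω : SiteConfig V | IsPivotal A v ω} ↑(F.erase v) :=
    Russo.determinedBy_isPivotal hF v
  have hcl : DeterminedBy {ω : SiteConfig V | v ∉ ω} ↑({v} : Finset V) := by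
    rw [determinedBy_iff]
    intro ω ω' h
    have := Set.ext_iff.1 h v
    simp only [Set.mem_inter_iff, Finset.coe_singleton, Set.mem_singleton_iff, and_true] at this
    simp only [Set.mem_setOf_eq]
    exact not_congr this
  have hdisj : Disjoint (F.erase v) {v} := by simp
  rw [sitePercolation_real_inter_of_disjoint p hpiv hcl hdisj]
  have hc : (sitePercolation V p).real {ω : SiteConfig V | v ∉ ω} = 1 - p := by
    have : {ω : SiteConfig V | v ∉ ω} = {ω : SiteConfig V | v ∈ ω}ᶜ := rfl
    rw [this, probReal_compl_eq_one_sub (measurableSet_mem v), sitePercolation_real_mem]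
  rw [hc, mul_comm]

/-- **Russo's formula, closed-pivotal form** (the form used by Duminil-Copin–Tassion 2016,
proof of Lemma 1.4): for an increasing event `A` determined by the finite set `F` and
`p ∈ (0, 1)`, `d/dq P_q(A) |_{q = p} = (1 - p)⁻¹ Σ_{v ∈ F} P_p(ω ∉ A, ω ∪ {v} ∈ A)`.
[cite: DuminilCopinTassionCMP2016, Lemma 1.4 (proof)] -/
theorem site_russo_formula_sum_closedPivotal {A : Set (SiteConfig V)} (hA : IsUpperSet A)
    (F : Finset V) (hF : DeterminedBy A ↑F) {p : ℝ} (hp : p ∈ Set.Ioo (0 : ℝ) 1) :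
    HasDerivAt (fun q : ℝ => (sitePercolation V (Set.projIcc 0 1 zero_le_one q)).real A)
      ((1 - p)⁻¹ * ∑ v ∈ F, (sitePercolation V (Set.projIcc 0 1 zero_le_one p)).real
        {ω | ω ∉ A ∧ insert v ω ∈ A}) p := by
  have hpI : p ∈ Set.Icc (0 : ℝ) 1 := ⟨hp.1.le, hp.2.le⟩
  refine (site_russo_formula_sum hA F hF hp).congr_deriv ?_
  rw [Finset.mul_sum]
  refine Finset.sum_congr rfl fun v _ => ?_
  rw [sitePercolation_real_not_mem_and_insert_mem _ hA hF v, Set.projIcc_of_mem _ hpI,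
    ← mul_assoc]
  have h1 : (1 : ℝ) - p ≠ 0 := (sub_pos.2 hp.2).ne'
  change _ = (1 - p)⁻¹ * (1 - p) * _
  rw [inv_mul_cancel₀ h1, one_mul]

end Literature.Probability.Percolation
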